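import Literature.MathematicalPhysics.QuantumFieldTheory.Balaban1983to89.B4Eq48FirstOrder

/-!
# `Balaban1983to89.B4Eq47Expansion` — T. Bałaban, *Regularity and decay of lattice Green's functions*, Commun. Math.
# Phys. **89** (1983) 571–597 [Balaban1983RegularityDecay], §4 p. 590 [PDF 20]: **the expansion of the left side of
# (4.7) with respect to `A′`** — «We expand the expression on the left hand side of (4.7) with respect to A′ … and we
# separate terms of first order in e» — as EXACT IDENTITIES on the actual objects (the operator (1.6), its Green's
# function, the averaging operators (1.4)): the difference of the left sides of (4.7) at two backgrounds, the remainder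
# after the first-order term (4.8), and the second-order structure of `H(A₀+A′) − H(A₀) − Ḣ`; plus the variational
# bound through which «Using Lemma 2.1» controls the genuinely second-order term

statement-level skeleton of published theorems with citation tags; proofs where landed; nothing here is a claim about the Yang–Mills mass gap

PDF held: `paper:balaban1983-cmp89-regularity-decay` (render `run/shared/lean/pub/pub-balaban/b2b-balaban-ref1/pages/
1983-cmp89-regularity-decay/1983-cmp89-regularity-decay-p020-x2.png`, READ AS IMAGE; journal page = PDF page + 570).

CITATION HEADER (lean-in-tree rule).  lit-balaban cell (HOME `run/shared/lean/pub/lit-balaban/`), block B4 (fold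
owner r01), SKELETON row **`B4.Eq4.11`** ((4.8)–(4.13)), the row's LAST OPEN HYPOTHESIS: the second-order remainder
bound `hR` of r01's `B4Ineq410GaugeOut.ineq411` / r04's `B4Ineq410FirstOrder.ineq411_box` («the remaining terms can be
easily estimated by O(e²p²(e))(|φ(x)|² + |φ(x′)|²)»).  This file is the ALGEBRAIC half of that step (what exactly «the
remaining terms» are); the estimate itself is the object of a follow-up file.  Written by the block's second reader,
unit `lit-balaban-r04` gen 12.  Inputs USED BY NAME, not re-proved: `B4GaugeCovariance` (the operators (1.3)–(1.6):
`bondDiff`, `covLap`, `avgOp`, `projOp`, `b4Op`, `b4Green`, `fieldLink`, `contourTrans`), `B4Eq12ExpFlow.expFlow`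
((1.2)), `B4Eq48FirstOrder` (`phiK0 = φ^{(k)}`, the derivatives `dT`/`dD`/`dLap`/`dH`, `firstOrder48` = (4.8),
`hasDerivAt_lhs47`, `raw_eq_envelope`), r01's `B4Ineq410GaugeOut.lhs47`/`qgq` (the left side of (4.7)).

## THE PRINT (verbatim, p. 590 [PDF 20]; `≦` written `≤`)

*"We will transform the left hand side of (4.7). Using the regularity condition for A, we write A = A₀ + A′ on Δ(x,x′)
with A₀ constant and A′ satisfying the bounds |A′|, |∂^η_μA′| ≤ O(1)p(e). We expand the expression on the left hand
side of (4.7) with respect to A′ using (I.3.15), (I.3.44), and we separate terms of first order in e. Using Lemma 2.1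
the remaining terms can be easily estimated by O(e²p²(e))(|φ(x)|² + |φ(x′)|²). Now let us consider the terms of first
order. … Denoting φ^{(k)} = a_kG_k(Δ(x,x′),A₀)Q_k^*(A₀)φ, we have the following expression [(4.8)]"* — the left side
of (4.7) being `a_k|φ(x)|² + a_k|φ(x′)|² − a_k²⟨φ, Q_k(A)G_k(Δ(x,x′),A)Q_k^*(A)φ⟩` ((4.7), p. 590).

## WHAT IS CERTIFIED (kernel theorems; zero `sorry`, standard axioms; no `Prop`-valued statement is introduced)

Notation (any finite carrier `X`, block labels `Y`, colour index `ι`; any `OrthFlow`, resp. the flow `e^{tq}` of (1.2)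
where derivatives enter): `H_i = H(A_i)` the operator (1.6) (`b4Op`), `G_i = H_i⁻¹` (`b4Green`), `Q_i = Q_k(A_i)`
(`avgOp` with the outer weights `qout` where it meets `φ`, the inner weights `qin` inside `H`), `p_i = Q_iᵀφ`,
`u_i = G_ip_i` (`uFld`; `φ^{(k)} = a_ku₀`), `D_i = D_{xy}(A_i)` the covariant bond difference (1.3) (`bondDiff`),
`Ḣ, Ḋ, Q̇` the `t`-derivatives at `0` along `A₀ + tA′` (`B4Eq48FirstOrder.dH/dD/avgOp·dT`), and the RESIDUAL
`r = (Q₁ − Q₀)ᵀφ − (H₁ − H₀)u₀` (`resid`).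
* §1 `uFld_sub_uFld` — `u₁ − u₀ = G₁r` (resolvent identity); **`lhs47_sub_lhs47`** — for ANY two fields `A₀, A₁` at
  which (1.6) is invertible and every `φ`:
  `LHS(4.7)(A₁) − LHS(4.7)(A₀) = −a_k²·[⟨r, G₁r⟩ + 2⟨u₀, (Q₁ − Q₀)ᵀφ⟩ − ⟨u₀, (H₁ − H₀)u₀⟩]` (exact; uses only
  `H₁ᵀ = H₁`, `H_iu_i = p_i`).
* §2 `firstOrder48_envelope` — (4.8) `= a_k²⟨u₀, Ḣu₀⟩ − 2a_k²⟨u₀, Q̇ᵀφ⟩`; **`remainder411_eq`** — THE REMAINDER: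
  `LHS(4.7)(A₀+A′) − LHS(4.7)(A₀) − (4.8) = −a_k²·[⟨r, G_k(Δ,A₀+A′)r⟩ + 2⟨u₀, (Q₁ − Q₀ − Q̇)ᵀφ⟩ − ⟨u₀, (H₁ − H₀ − Ḣ)u₀⟩]`.
* §3 the second-order structure: `b4Op_sub_sub_dH` — `H₁ − H₀ − Ḣ = Σ_{x,y} c(x,y)[(D₁−D₀)ᵀ(D₁−D₀) + D₀ᵀ(D₁−D₀−Ḋ) +
  (D₁−D₀−Ḋ)ᵀD₀] + a[(Q₁−Q₀)ᵀ(Q₁−Q₀) + Q₀ᵀ(Q₁−Q₀−Q̇) + (Q₁−Q₀−Q̇)ᵀQ₀]` (the mass term cancels) and its quadratic form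
  `form_b4Op_sub_sub_dH` (`Σ c[|(D₁−D₀)u|² + 2⟨D₀u,(D₁−D₀−Ḋ)u⟩] + a[|(Q₁−Q₀)u|² + 2⟨Q₀u,(Q₁−Q₀−Q̇)u⟩]`); the
  first-order (polarised) forms `b4Op_sub_eq` (`H₁ − H₀ = Σ c[(D₁−D₀)ᵀD₁ + D₀ᵀ(D₁−D₀)] + a[(Q₁−Q₀)ᵀQ₁ + Q₀ᵀ(Q₁−Q₀)]`, any
  flow) and `form_b4Op_sub` (the bilinear form `⟨u, (H₁−H₀)y⟩`, every summand carrying ONE difference of link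
  variables — the shape in which `⟨r, y⟩` is estimated); the ring identities `transpose_mul_sub_split`/`…split₁`.
* §4 `dotProduct_inv_mulVec_le_of_forall` — if `2⟨r,y⟩ − ⟨y,Hy⟩ ≤ M` for all `y` then `⟨r, H⁻¹r⟩ ≤ M` (invertible
  `H`); `dotProduct_inv_mulVec_nonneg` — `0 ≤ ⟨r, H⁻¹r⟩` for positive definite `H` (so `|⟨r, G₁r⟩| ≤ M`): the device by
  which the uniform positivity (1.8) of `H(A₀+A′)` (Lemma 2.1's input, `B4Lower18Regular`) bounds the second-order term
  without an operator norm of `G₁` against the (large) `ℓ²`-norm of `r`.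

## HONEST SCOPE

(i) EXACT ALGEBRA ONLY: no smallness of `A′`, no estimate — the bound `O(e²p²(e))(|φ(x)|² + |φ(x′)|²)` of the three
brackets of `remainder411_eq` on the two-block box (the hypothesis `hR` of `ineq411`/`ineq411_box`) is NOT proved here.
(ii) The print expands «using (I.3.15), (I.3.44)» (the perturbative formulae of paper I); this file expands directly by
the resolvent identity — the same terms, organised as `(first order) + (remainder)` rather than as a power series; the
identification of the first-order part with the printed (4.8) is `B4Eq48FirstOrder.hasDerivAt_lhs47` (used in
`firstOrder48_envelope`).  (iii) `A₀` is not assumed constant and `Δ(x,x′)` is not assumed a two-block box: the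
identities hold on every finite carrier; the box enters only with the estimates.  (iv) Symmetry of (1.6)
(`B4Lemma22DualL1.b4Op_transpose`, re-derived inline to keep the import list at `B4Eq48FirstOrder`) is the only
structural input.
-/

namespace Literature.MathematicalPhysics.QuantumFieldTheory.Balaban1983to89.B4Eq47Expansion

open Finset Matrix
open Literature.MathematicalPhysics.QuantumFieldTheory.Balaban1983to89.B4GaugeCovariance
open Literature.MathematicalPhysics.QuantumFieldTheory.Balaban1983to89.B4Ineq410GaugeOut (qgq lhs47)
open Literature.MathematicalPhysics.QuantumFieldTheory.Balaban1983to89.B4Eq12ExpFlow (expFlow expFlow_U)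
open Literature.MathematicalPhysics.QuantumFieldTheory.Balaban1983to89.B4Eq48FirstOrder
  (phiK0 dAvg dT dD dLap dH firstOrder48 hasDerivAt_lhs47 raw_eq_envelope hasDerivAt_lhs47_raw)

noncomputable section

/-! ## §1. The exact expansion of the left side of (4.7) about a background: `LHS(4.7)(A₁) − LHS(4.7)(A₀)` -/

section Exact

variable {X Y ι : Type*} [Fintype X] [Fintype Y] [Fintype ι] [DecidableEq X] [DecidableEq Y] [DecidableEq ι]

/-- `u = G_k(Δ,A)Q_k^*(A)φ` — the field `φ^{(k)}/a_k` of p. 590 at the background `A` (`B4Eq48FirstOrder.phiK0 = a_k • u`).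
[cite: Balaban1983RegularityDecay, p.590 «φ^{(k)} = a_kG_k(Δ(x,x′),A₀)Q_k^*(A₀)φ»] -/
def uFld (F : OrthFlow ι) (κ : ℝ) (c : X → X → ℝ) (m2 a : ℝ) (qin qout : Y → X → ℝ) (emb : Y → X)
    (Γ : Y → X → List X) (A : X → X → ℝ) (Ψ : Y × ι → ℝ) : X × ι → ℝ :=
  b4Green F κ c m2 a qin emb Γ A *ᵥ ((avgOp qout (contourTrans (fieldLink F κ A) emb Γ))ᵀ *ᵥ Ψ)

/-- THE SECOND-ORDER RESIDUAL VECTOR of the expansion about `A₀`: `r = (Q_k(A₁) − Q_k(A₀))^*φ − (H(A₁) − H(A₀))u₀`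
(`u₀ = G_k(Δ,A₀)Q_k^*(A₀)φ`), so that `u₁ − u₀ = G_k(Δ,A₁)r`. [cite: Balaban1983RegularityDecay, p.590 «we expand the expression on the left hand side of (4.7) with respect to A′»] -/
def resid (F : OrthFlow ι) (κ : ℝ) (c : X → X → ℝ) (m2 a : ℝ) (qin qout : Y → X → ℝ) (emb : Y → X)
    (Γ : Y → X → List X) (A₀ A₁ : X → X → ℝ) (Ψ : Y × ι → ℝ) : X × ι → ℝ :=
  (avgOp qout (contourTrans (fieldLink F κ A₁) emb Γ) - avgOp qout (contourTrans (fieldLink F κ A₀) emb Γ))ᵀ *ᵥ Ψ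
    - (b4Op F κ c m2 a qin emb Γ A₁ - b4Op F κ c m2 a qin emb Γ A₀) *ᵥ uFld F κ c m2 a qin qout emb Γ A₀ Ψ

omit [DecidableEq Y] in
/-- **`u₁ − u₀ = G_k(Δ,A₁)·r`**: the difference of the fields `G_kQ_k^*φ` at two backgrounds is the Green's function at
`A₁` applied to the residual (resolvent identity). [cite: Balaban1983RegularityDecay, p.590] -/
theorem uFld_sub_uFld (F : OrthFlow ι) (κ : ℝ) (c : X → X → ℝ) (m2 a : ℝ) (qin qout : Y → X → ℝ) (emb : Y → X)
    (Γ : Y → X → List X) (A₀ A₁ : X → X → ℝ) (Ψ : Y × ι → ℝ)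
    (h0 : IsUnit (b4Op F κ c m2 a qin emb Γ A₀).det) (h1 : IsUnit (b4Op F κ c m2 a qin emb Γ A₁).det) :
    uFld F κ c m2 a qin qout emb Γ A₁ Ψ - uFld F κ c m2 a qin qout emb Γ A₀ Ψ
      = b4Green F κ c m2 a qin emb Γ A₁ *ᵥ resid F κ c m2 a qin qout emb Γ A₀ A₁ Ψ := by
  set H₀ := b4Op F κ c m2 a qin emb Γ A₀ with hH₀
  set H₁ := b4Op F κ c m2 a qin emb Γ A₁ with hH₁
  set p₀ := (avgOp qout (contourTrans (fieldLink F κ A₀) emb Γ))ᵀ *ᵥ Ψ with hp₀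
  set p₁ := (avgOp qout (contourTrans (fieldLink F κ A₁) emb Γ))ᵀ *ᵥ Ψ with hp₁
  have hu₀ : uFld F κ c m2 a qin qout emb Γ A₀ Ψ = H₀⁻¹ *ᵥ p₀ := rfl
  have hu₁ : uFld F κ c m2 a qin qout emb Γ A₁ Ψ = H₁⁻¹ *ᵥ p₁ := rfl
  have hr : resid F κ c m2 a qin qout emb Γ A₀ A₁ Ψ = p₁ - p₀ - (H₁ - H₀) *ᵥ (H₀⁻¹ *ᵥ p₀) := by
    rw [resid, hu₀, Matrix.transpose_sub, Matrix.sub_mulVec]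
  have hG : b4Green F κ c m2 a qin emb Γ A₁ = H₁⁻¹ := rfl
  have hH0u0 : H₀ *ᵥ (H₀⁻¹ *ᵥ p₀) = p₀ := by
    rw [Matrix.mulVec_mulVec, Matrix.mul_nonsing_inv _ h0, Matrix.one_mulVec]
  have hG1H1 : H₁⁻¹ *ᵥ (H₁ *ᵥ (H₀⁻¹ *ᵥ p₀)) = H₀⁻¹ *ᵥ p₀ := by
    rw [Matrix.mulVec_mulVec, Matrix.nonsing_inv_mul _ h1, Matrix.one_mulVec]
  rw [hu₀, hu₁, hr, hG, Matrix.sub_mulVec, hH0u0, Matrix.mulVec_sub, Matrix.mulVec_sub, Matrix.mulVec_sub, hG1H1]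
  abel

omit [DecidableEq Y] in
/-- **THE EXACT EXPANSION OF THE LEFT SIDE OF (4.7) ABOUT A BACKGROUND** («We expand the expression on the left hand
side of (4.7) with respect to A′», p. 590): for any two fields `A₀`, `A₁` at which (1.6) is invertible and every `φ`,
`LHS(4.7)(A₁) − LHS(4.7)(A₀) = −a_k²·[⟨r, G_k(Δ,A₁)r⟩ + 2⟨u₀, (Q_k(A₁) − Q_k(A₀))^*φ⟩ − ⟨u₀, (H(A₁) − H(A₀))u₀⟩]`
with `u₀ = G_k(Δ,A₀)Q_k^*(A₀)φ` and the residual `r` (`resid`) — exact, no smallness. The middle and last brackets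
carry the first-order terms (4.8); `⟨r, G₁r⟩` is of second order. [cite: Balaban1983RegularityDecay, (4.7) p.590, (4.11) p.591] -/
theorem lhs47_sub_lhs47 (F : OrthFlow ι) (κ : ℝ) (c : X → X → ℝ) (m2 a : ℝ) (qin qout : Y → X → ℝ) (emb : Y → X)
    (Γ : Y → X → List X) (ak : ℝ) (A₀ A₁ : X → X → ℝ) (Ψ : Y × ι → ℝ)
    (h0 : IsUnit (b4Op F κ c m2 a qin emb Γ A₀).det) (h1 : IsUnit (b4Op F κ c m2 a qin emb Γ A₁).det) :
    lhs47 F κ c m2 a qin qout emb Γ ak A₁ Ψ - lhs47 F κ c m2 a qin qout emb Γ ak A₀ Ψ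
      = -(ak ^ 2 * (resid F κ c m2 a qin qout emb Γ A₀ A₁ Ψ
              ⬝ᵥ (b4Green F κ c m2 a qin emb Γ A₁ *ᵥ resid F κ c m2 a qin qout emb Γ A₀ A₁ Ψ)
          + 2 * (uFld F κ c m2 a qin qout emb Γ A₀ Ψ
              ⬝ᵥ ((avgOp qout (contourTrans (fieldLink F κ A₁) emb Γ)
                    - avgOp qout (contourTrans (fieldLink F κ A₀) emb Γ))ᵀ *ᵥ Ψ))
          - uFld F κ c m2 a qin qout emb Γ A₀ Ψ
              ⬝ᵥ ((b4Op F κ c m2 a qin emb Γ A₁ - b4Op F κ c m2 a qin emb Γ A₀)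
                    *ᵥ uFld F κ c m2 a qin qout emb Γ A₀ Ψ))) := by
  have hGr := uFld_sub_uFld F κ c m2 a qin qout emb Γ A₀ A₁ Ψ h0 h1
  set H₀ := b4Op F κ c m2 a qin emb Γ A₀ with hH₀
  set H₁ := b4Op F κ c m2 a qin emb Γ A₁ with hH₁
  set Q₀ := avgOp qout (contourTrans (fieldLink F κ A₀) emb Γ) with hQ₀
  set Q₁ := avgOp qout (contourTrans (fieldLink F κ A₁) emb Γ) with hQ₁
  set p₀ := Q₀ᵀ *ᵥ Ψ with hp₀
  set p₁ := Q₁ᵀ *ᵥ Ψ with hp₁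
  set u₀ := uFld F κ c m2 a qin qout emb Γ A₀ Ψ with hu₀
  set u₁ := uFld F κ c m2 a qin qout emb Γ A₁ Ψ with hu₁
  set r := resid F κ c m2 a qin qout emb Γ A₀ A₁ Ψ with hr
  -- the two sides of (4.7) as `a_k|Ψ|² − a_k²⟨p, u⟩`
  have hL1 : lhs47 F κ c m2 a qin qout emb Γ ak A₁ Ψ = ak * (Ψ ⬝ᵥ Ψ) - ak ^ 2 * (p₁ ⬝ᵥ u₁) := by
    unfold lhs47 qgq
    rw [← Matrix.mulVec_mulVec, ← Matrix.mulVec_mulVec, Matrix.dotProduct_mulVec, ← Matrix.mulVec_transpose]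
    rfl
  have hL0 : lhs47 F κ c m2 a qin qout emb Γ ak A₀ Ψ = ak * (Ψ ⬝ᵥ Ψ) - ak ^ 2 * (p₀ ⬝ᵥ u₀) := by
    unfold lhs47 qgq
    rw [← Matrix.mulVec_mulVec, ← Matrix.mulVec_mulVec, Matrix.dotProduct_mulVec, ← Matrix.mulVec_transpose]
    rfl
  -- matrix facts: (1.6) is symmetric (`B4Lemma22DualL1.b4Op_transpose`, re-derived inline to keep the imports low)
  have hH₁s : H₁ᵀ = H₁ := by
    rw [hH₁]
    unfold b4Op covOp projOp covLap
    simp only [Matrix.transpose_add, Matrix.transpose_sum, Matrix.transpose_smul, Matrix.transpose_mul,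
      Matrix.transpose_transpose, Matrix.transpose_one]
  have hHu₀ : H₀ *ᵥ u₀ = p₀ := by
    rw [hu₀, uFld, b4Green, Matrix.mulVec_mulVec, Matrix.mul_nonsing_inv _ h0, Matrix.one_mulVec]
  have hHu₁ : H₁ *ᵥ u₁ = p₁ := by
    rw [hu₁, uFld, b4Green, Matrix.mulVec_mulVec, Matrix.mul_nonsing_inv _ h1, Matrix.one_mulVec]
  have t1 : (H₁ *ᵥ u₀) ⬝ᵥ u₁ = p₁ ⬝ᵥ u₀ := by
    rw [dotProduct_comm, Matrix.dotProduct_mulVec u₁ H₁ u₀, ← Matrix.mulVec_transpose, hH₁s, hHu₁]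
  have e3 : (H₁ *ᵥ u₀) ⬝ᵥ u₀ = u₀ ⬝ᵥ (H₁ *ᵥ u₀) := dotProduct_comm _ _
  have cm1 : u₀ ⬝ᵥ p₁ = p₁ ⬝ᵥ u₀ := dotProduct_comm _ _
  have cm2 : u₀ ⬝ᵥ p₀ = p₀ ⬝ᵥ u₀ := dotProduct_comm _ _
  -- `r·G₁r = r·(u₁ − u₀)`, expand `r`
  have e1 : r ⬝ᵥ (b4Green F κ c m2 a qin emb Γ A₁ *ᵥ r) = r ⬝ᵥ (u₁ - u₀) := by rw [← hGr]
  have hr' : r = (p₁ - p₀) - (H₁ *ᵥ u₀ - p₀) := by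
    rw [hr, resid, Matrix.transpose_sub, Matrix.sub_mulVec, Matrix.sub_mulVec, ← hu₀, hHu₀]
  have key : r ⬝ᵥ (b4Green F κ c m2 a qin emb Γ A₁ *ᵥ r) + 2 * (u₀ ⬝ᵥ ((Q₁ - Q₀)ᵀ *ᵥ Ψ))
      - u₀ ⬝ᵥ ((H₁ - H₀) *ᵥ u₀) = p₁ ⬝ᵥ u₁ - p₀ ⬝ᵥ u₀ := by
    rw [e1, hr', Matrix.transpose_sub, Matrix.sub_mulVec, Matrix.sub_mulVec, hHu₀, ← hp₀, ← hp₁]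
    simp only [sub_dotProduct, dotProduct_sub]
    linear_combination (-1 : ℝ) * t1 + e3 + 2 * cm1 - cm2
  rw [hL1, hL0, key]
  ring

end Exact

/-! ## §2. «… and we separate terms of first order in e»: the remainder after the first-order term (4.8) -/

section Remainder

variable {X Y ι : Type*} [Fintype X] [Fintype Y] [Fintype ι] [DecidableEq X] [DecidableEq Y] [DecidableEq ι]
variable (q : Matrix ι ι ℝ) (hq : qᵀ = -q) (κ : ℝ)

/-- **THE FIRST-ORDER TERM (4.8) IN ENVELOPE FORM**: `(4.8) = a_k²⟨u₀, Ḣu₀⟩ − 2a_k²⟨u₀, Q̇^*φ⟩` (`u₀ = G_kQ_k^*φ` at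
`A₀`, `Ḣ = B4Eq48FirstOrder.dH`, `Q̇ = avgOp q′ dT` the derivatives along `A₀ + tA′`) — the printed three lines are the
quadratic form of `Ḣ` at `φ^{(k)} = a_ku₀` minus `2a_k⟨φ, Q̇φ^{(k)}⟩` (`B4Eq48FirstOrder.raw_eq_envelope`, uniqueness of the
derivative). [cite: Balaban1983RegularityDecay, (4.8) p.590] -/
theorem firstOrder48_envelope (c : X → X → ℝ) (m2 a : ℝ) (qin qout : Y → X → ℝ) (emb : Y → X)
    (Γ : Y → X → List X) (ak : ℝ) (A₀ A' : X → X → ℝ) (Ψ : Y × ι → ℝ)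
    (hU : IsUnit (b4Op (expFlow q hq) κ c m2 a qin emb Γ A₀)) :
    firstOrder48 q hq κ c m2 a qin qout emb Γ ak A₀ A' Ψ
      = ak ^ 2 * (uFld (expFlow q hq) κ c m2 a qin qout emb Γ A₀ Ψ
            ⬝ᵥ (dH q hq κ c a qin emb Γ A₀ A' *ᵥ uFld (expFlow q hq) κ c m2 a qin qout emb Γ A₀ Ψ))
        - 2 * ak ^ 2 * (uFld (expFlow q hq) κ c m2 a qin qout emb Γ A₀ Ψ
            ⬝ᵥ ((avgOp qout (dT q hq κ emb Γ A₀ A'))ᵀ *ᵥ Ψ)) := by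
  have h1 := hasDerivAt_lhs47 q hq κ c m2 a qin qout emb Γ ak A₀ A' Ψ hU
  have h2 := hasDerivAt_lhs47_raw q hq κ c m2 a qin qout emb Γ ak A₀ A' Ψ hU
  rw [h1.unique h2, raw_eq_envelope q hq]
  have hphi : phiK0 q hq κ c m2 a qin qout emb Γ ak A₀ Ψ = ak • uFld (expFlow q hq) κ c m2 a qin qout emb Γ A₀ Ψ := rfl
  rw [hphi, Matrix.mulVec_smul, Matrix.mulVec_smul, smul_dotProduct, dotProduct_smul, dotProduct_smul,
    Matrix.dotProduct_mulVec Ψ (avgOp qout (dT q hq κ emb Γ A₀ A')), ← Matrix.mulVec_transpose]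
  simp only [smul_eq_mul]
  rw [dotProduct_comm ((avgOp qout (dT q hq κ emb Γ A₀ A'))ᵀ *ᵥ Ψ)]
  ring

/-- **THE REMAINDER OF THE EXPANSION AFTER THE FIRST-ORDER TERM (4.8)** — the object of «Using Lemma 2.1 the
remaining terms can be easily estimated by O(e²p²(e))(|φ(x)|² + |φ(x′)|²)» (p. 590), EXACTLY:
`LHS(4.7)(A₀+A′) − LHS(4.7)(A₀) − (4.8) = −a_k²·[⟨r, G_k(Δ,A₀+A′)r⟩ + 2⟨u₀, (Q_k(A₀+A′) − Q_k(A₀) − Q̇)^*φ⟩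
 − ⟨u₀, (H(A₀+A′) − H(A₀) − Ḣ)u₀⟩]` — every bracket is of second order in `A′` (`r` is of first order, `Q − Q₀ − Q̇`
and `H − H₀ − Ḣ` are Taylor remainders of the link variables `e^{qeηA}`). [cite: Balaban1983RegularityDecay, p.590, (4.11) p.591] -/
theorem remainder411_eq (c : X → X → ℝ) (m2 a : ℝ) (qin qout : Y → X → ℝ) (emb : Y → X) (Γ : Y → X → List X)
    (ak : ℝ) (A₀ A' : X → X → ℝ) (Ψ : Y × ι → ℝ) (h0 : IsUnit (b4Op (expFlow q hq) κ c m2 a qin emb Γ A₀).det)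
    (h1 : IsUnit (b4Op (expFlow q hq) κ c m2 a qin emb Γ (A₀ + A')).det) :
    lhs47 (expFlow q hq) κ c m2 a qin qout emb Γ ak (A₀ + A') Ψ - lhs47 (expFlow q hq) κ c m2 a qin qout emb Γ ak A₀ Ψ
        - firstOrder48 q hq κ c m2 a qin qout emb Γ ak A₀ A' Ψ
      = -(ak ^ 2 * (resid (expFlow q hq) κ c m2 a qin qout emb Γ A₀ (A₀ + A') Ψ
              ⬝ᵥ (b4Green (expFlow q hq) κ c m2 a qin emb Γ (A₀ + A')
                    *ᵥ resid (expFlow q hq) κ c m2 a qin qout emb Γ A₀ (A₀ + A') Ψ)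
          + 2 * (uFld (expFlow q hq) κ c m2 a qin qout emb Γ A₀ Ψ
              ⬝ᵥ ((avgOp qout (contourTrans (fieldLink (expFlow q hq) κ (A₀ + A')) emb Γ)
                    - avgOp qout (contourTrans (fieldLink (expFlow q hq) κ A₀) emb Γ)
                    - avgOp qout (dT q hq κ emb Γ A₀ A'))ᵀ *ᵥ Ψ))
          - uFld (expFlow q hq) κ c m2 a qin qout emb Γ A₀ Ψ
              ⬝ᵥ ((b4Op (expFlow q hq) κ c m2 a qin emb Γ (A₀ + A') - b4Op (expFlow q hq) κ c m2 a qin emb Γ A₀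
                      - dH q hq κ c a qin emb Γ A₀ A')
                    *ᵥ uFld (expFlow q hq) κ c m2 a qin qout emb Γ A₀ Ψ))) := by
  have hU : IsUnit (b4Op (expFlow q hq) κ c m2 a qin emb Γ A₀) := (Matrix.isUnit_iff_isUnit_det _).2 h0
  rw [lhs47_sub_lhs47 (expFlow q hq) κ c m2 a qin qout emb Γ ak A₀ (A₀ + A') Ψ h0 h1,
    firstOrder48_envelope q hq κ c m2 a qin qout emb Γ ak A₀ A' Ψ hU]
  simp only [Matrix.transpose_sub, Matrix.sub_mulVec, dotProduct_sub]
  ring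

end Remainder

/-! ## §3. The second-order structure of `H(A₀+A′) − H(A₀) − Ḣ` (the covariant Laplacian (1.3) and `a_kP_k` (1.5)):
exact identities reducing the remainder to the link-variable Taylor remainders `U − U₀ − U̇` and squares `(U − U₀)²` -/

section Split

variable {X Y ι : Type*} [Fintype X] [Fintype Y] [Fintype ι] [DecidableEq X] [DecidableEq Y] [DecidableEq ι]

omit [Fintype X] [Fintype Y] [DecidableEq X] [DecidableEq Y] [DecidableEq ι] in
/-- the ring identity behind the second-order split: `X₁ᵀX₁ − X₀ᵀX₀ − (X₀ᵀZ + ZᵀX₀) = (X₁−X₀)ᵀ(X₁−X₀) + X₀ᵀ(X₁−X₀−Z) +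
(X₁−X₀−Z)ᵀX₀` (`Z` the derivative of `X` at `X₀`). [cite: Balaban1983RegularityDecay, p.590 «we separate terms of first order»] -/
theorem transpose_mul_sub_split {m n : Type*} [Fintype m] (X₁ X₀ Z : Matrix m n ℝ) :
    X₁ᵀ * X₁ - X₀ᵀ * X₀ - (X₀ᵀ * Z + Zᵀ * X₀)
      = (X₁ - X₀)ᵀ * (X₁ - X₀) + X₀ᵀ * (X₁ - X₀ - Z) + (X₁ - X₀ - Z)ᵀ * X₀ := by
  simp only [Matrix.transpose_sub, Matrix.sub_mul, Matrix.mul_sub]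
  abel

variable (q : Matrix ι ι ℝ) (hq : qᵀ = -q) (κ : ℝ)

omit [DecidableEq Y] in
/-- **`H(A₀+A′) − H(A₀) − Ḣ` IN SECOND-ORDER FORM**: with `D₁, D₀` the covariant bond differences (1.3) at `A₀ + A′`,
`A₀`, `Ḋ` their derivative (`B4Eq48FirstOrder.dD`), `Q₁, Q₀, Q̇` the averaging operators (1.4) and their derivative:
`H₁ − H₀ − Ḣ = Σ_{x,y} c(x,y)[(D₁−D₀)ᵀ(D₁−D₀) + D₀ᵀ(D₁−D₀−Ḋ) + (D₁−D₀−Ḋ)ᵀD₀] + a[(Q₁−Q₀)ᵀ(Q₁−Q₀) + Q₀ᵀ(Q₁−Q₀−Q̇) +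
(Q₁−Q₀−Q̇)ᵀQ₀]` (the mass term cancels). [cite: Balaban1983RegularityDecay, (1.3)–(1.6) p.572, p.590] -/
theorem b4Op_sub_sub_dH (c : X → X → ℝ) (m2 a : ℝ) (qin : Y → X → ℝ) (emb : Y → X) (Γ : Y → X → List X)
    (A₀ A' : X → X → ℝ) :
    b4Op (expFlow q hq) κ c m2 a qin emb Γ (A₀ + A') - b4Op (expFlow q hq) κ c m2 a qin emb Γ A₀
        - dH q hq κ c a qin emb Γ A₀ A'
      = (∑ x, ∑ y, c x y •
          ((bondDiff (fieldLink (expFlow q hq) κ (A₀ + A')) x y - bondDiff (fieldLink (expFlow q hq) κ A₀) x y)ᵀ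
              * (bondDiff (fieldLink (expFlow q hq) κ (A₀ + A')) x y - bondDiff (fieldLink (expFlow q hq) κ A₀) x y)
            + (bondDiff (fieldLink (expFlow q hq) κ A₀) x y)ᵀ
              * (bondDiff (fieldLink (expFlow q hq) κ (A₀ + A')) x y - bondDiff (fieldLink (expFlow q hq) κ A₀) x y
                  - dD q hq κ A₀ A' x y)
            + (bondDiff (fieldLink (expFlow q hq) κ (A₀ + A')) x y - bondDiff (fieldLink (expFlow q hq) κ A₀) x y
                  - dD q hq κ A₀ A' x y)ᵀ * bondDiff (fieldLink (expFlow q hq) κ A₀) x y))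
        + a • ((avgOp qin (contourTrans (fieldLink (expFlow q hq) κ (A₀ + A')) emb Γ)
                  - avgOp qin (contourTrans (fieldLink (expFlow q hq) κ A₀) emb Γ))ᵀ
                * (avgOp qin (contourTrans (fieldLink (expFlow q hq) κ (A₀ + A')) emb Γ)
                  - avgOp qin (contourTrans (fieldLink (expFlow q hq) κ A₀) emb Γ))
              + (avgOp qin (contourTrans (fieldLink (expFlow q hq) κ A₀) emb Γ))ᵀ
                * (avgOp qin (contourTrans (fieldLink (expFlow q hq) κ (A₀ + A')) emb Γ)
                  - avgOp qin (contourTrans (fieldLink (expFlow q hq) κ A₀) emb Γ) - avgOp qin (dT q hq κ emb Γ A₀ A'))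
              + (avgOp qin (contourTrans (fieldLink (expFlow q hq) κ (A₀ + A')) emb Γ)
                  - avgOp qin (contourTrans (fieldLink (expFlow q hq) κ A₀) emb Γ) - avgOp qin (dT q hq κ emb Γ A₀ A'))ᵀ
                * avgOp qin (contourTrans (fieldLink (expFlow q hq) κ A₀) emb Γ)) := by
  simp_rw [← transpose_mul_sub_split]
  unfold b4Op covOp projOp covLap dH dLap
  simp only [smul_sub, smul_add, Finset.sum_sub_distrib, Finset.sum_add_distrib]
  abel

omit [DecidableEq X] [DecidableEq Y] [DecidableEq ι] in
/-- `⟨u, (MᵀN)u⟩ = ⟨Mu, Nu⟩`. [folklore] -/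
private theorem dotProduct_transpose_mul_mulVec' {Z : Type*} [Fintype Z] (M N : Matrix Z (X × ι) ℝ)
    (u v : X × ι → ℝ) : u ⬝ᵥ ((Mᵀ * N) *ᵥ v) = (M *ᵥ u) ⬝ᵥ (N *ᵥ v) := by
  rw [← Matrix.mulVec_mulVec, Matrix.dotProduct_mulVec, Matrix.vecMul_transpose]

omit [DecidableEq X] [DecidableEq Y] [DecidableEq ι] in
/-- the quadratic form of the split: `⟨u, [(X₁−X₀)ᵀ(X₁−X₀) + X₀ᵀW + WᵀX₀]u⟩ = |(X₁−X₀)u|² + 2⟨X₀u, Wu⟩`. [folklore] -/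
private theorem form_of_split {Z : Type*} [Fintype Z] (X₁ X₀ W : Matrix Z (X × ι) ℝ) (u : X × ι → ℝ) :
    u ⬝ᵥ (((X₁ - X₀)ᵀ * (X₁ - X₀) + X₀ᵀ * W + Wᵀ * X₀) *ᵥ u)
      = ((X₁ - X₀) *ᵥ u) ⬝ᵥ ((X₁ - X₀) *ᵥ u) + 2 * ((X₀ *ᵥ u) ⬝ᵥ (W *ᵥ u)) := by
  rw [Matrix.add_mulVec, Matrix.add_mulVec, dotProduct_add, dotProduct_add, dotProduct_transpose_mul_mulVec',
    dotProduct_transpose_mul_mulVec', dotProduct_transpose_mul_mulVec', dotProduct_comm (W *ᵥ u)]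
  ring

omit [DecidableEq Y] in
/-- **THE QUADRATIC FORM OF `H(A₀+A′) − H(A₀) − Ḣ` AT `u`** (the last bracket of `remainder411_eq`):
`⟨u,(H₁−H₀−Ḣ)u⟩ = Σ_{x,y} c(x,y)[|(D₁−D₀)u|² + 2⟨D₀u, (D₁−D₀−Ḋ)u⟩] + a[|(Q₁−Q₀)u|² + 2⟨Q₀u, (Q₁−Q₀−Q̇)u⟩]` — squares of
first-order differences of the link variables and pairings of the zeroth-order quantities with their SECOND-ORDER
Taylor remainders. [cite: Balaban1983RegularityDecay, (1.3)–(1.6) p.572, p.590 «the remaining terms»] -/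
theorem form_b4Op_sub_sub_dH (c : X → X → ℝ) (m2 a : ℝ) (qin : Y → X → ℝ) (emb : Y → X) (Γ : Y → X → List X)
    (A₀ A' : X → X → ℝ) (u : X × ι → ℝ) :
    u ⬝ᵥ ((b4Op (expFlow q hq) κ c m2 a qin emb Γ (A₀ + A') - b4Op (expFlow q hq) κ c m2 a qin emb Γ A₀
              - dH q hq κ c a qin emb Γ A₀ A') *ᵥ u)
      = (∑ x, ∑ y, c x y *
          (((bondDiff (fieldLink (expFlow q hq) κ (A₀ + A')) x y - bondDiff (fieldLink (expFlow q hq) κ A₀) x y) *ᵥ u)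
              ⬝ᵥ ((bondDiff (fieldLink (expFlow q hq) κ (A₀ + A')) x y - bondDiff (fieldLink (expFlow q hq) κ A₀) x y)
                    *ᵥ u)
            + 2 * ((bondDiff (fieldLink (expFlow q hq) κ A₀) x y *ᵥ u)
              ⬝ᵥ ((bondDiff (fieldLink (expFlow q hq) κ (A₀ + A')) x y - bondDiff (fieldLink (expFlow q hq) κ A₀) x y
                    - dD q hq κ A₀ A' x y) *ᵥ u))))
        + a * ((((avgOp qin (contourTrans (fieldLink (expFlow q hq) κ (A₀ + A')) emb Γ)
                    - avgOp qin (contourTrans (fieldLink (expFlow q hq) κ A₀) emb Γ)) *ᵥ u)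
                ⬝ᵥ ((avgOp qin (contourTrans (fieldLink (expFlow q hq) κ (A₀ + A')) emb Γ)
                    - avgOp qin (contourTrans (fieldLink (expFlow q hq) κ A₀) emb Γ)) *ᵥ u))
              + 2 * ((avgOp qin (contourTrans (fieldLink (expFlow q hq) κ A₀) emb Γ) *ᵥ u)
                ⬝ᵥ ((avgOp qin (contourTrans (fieldLink (expFlow q hq) κ (A₀ + A')) emb Γ)
                    - avgOp qin (contourTrans (fieldLink (expFlow q hq) κ A₀) emb Γ) - avgOp qin (dT q hq κ emb Γ A₀ A'))
                    *ᵥ u))) := by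
  rw [b4Op_sub_sub_dH q hq κ c m2 a qin emb Γ A₀ A', Matrix.add_mulVec, dotProduct_add, Matrix.sum_mulVec,
    dotProduct_sum, Matrix.smul_mulVec, dotProduct_smul, smul_eq_mul, form_of_split]
  congr 1
  refine Finset.sum_congr rfl fun x _ => ?_
  rw [Matrix.sum_mulVec, dotProduct_sum]
  refine Finset.sum_congr rfl fun y _ => ?_
  rw [Matrix.smul_mulVec, dotProduct_smul, smul_eq_mul, form_of_split]

omit [Fintype X] [Fintype Y] [DecidableEq X] [DecidableEq Y] [DecidableEq ι] in
/-- the ring identity behind the first-order split: `X₁ᵀX₁ − X₀ᵀX₀ = (X₁−X₀)ᵀX₁ + X₀ᵀ(X₁−X₀)`.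
[cite: Balaban1983RegularityDecay, p.590 «we expand … with respect to A′»] -/
theorem transpose_mul_sub_split₁ {m n : Type*} [Fintype m] (X₁ X₀ : Matrix m n ℝ) :
    X₁ᵀ * X₁ - X₀ᵀ * X₀ = (X₁ - X₀)ᵀ * X₁ + X₀ᵀ * (X₁ - X₀) := by
  simp only [Matrix.transpose_sub, Matrix.sub_mul, Matrix.mul_sub]
  abel

omit [DecidableEq Y] in
/-- **`H(A₁) − H(A₀)` IN FIRST-ORDER (POLARISED) FORM**: `H₁ − H₀ = Σ_{x,y} c(x,y)[(D₁−D₀)ᵀD₁ + D₀ᵀ(D₁−D₀)] +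
a[(Q₁−Q₀)ᵀQ₁ + Q₀ᵀ(Q₁−Q₀)]` (any flow, any two fields) — the operator entering the residual `r`.
[cite: Balaban1983RegularityDecay, (1.3)–(1.6) p.572, p.590] -/
theorem b4Op_sub_eq (F : OrthFlow ι) (κ : ℝ) (c : X → X → ℝ) (m2 a : ℝ) (qin : Y → X → ℝ) (emb : Y → X)
    (Γ : Y → X → List X) (A₀ A₁ : X → X → ℝ) :
    b4Op F κ c m2 a qin emb Γ A₁ - b4Op F κ c m2 a qin emb Γ A₀
      = (∑ x, ∑ y, c x y •
          ((bondDiff (fieldLink F κ A₁) x y - bondDiff (fieldLink F κ A₀) x y)ᵀ * bondDiff (fieldLink F κ A₁) x y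
            + (bondDiff (fieldLink F κ A₀) x y)ᵀ * (bondDiff (fieldLink F κ A₁) x y - bondDiff (fieldLink F κ A₀) x y)))
        + a • ((avgOp qin (contourTrans (fieldLink F κ A₁) emb Γ) - avgOp qin (contourTrans (fieldLink F κ A₀) emb Γ))ᵀ
                * avgOp qin (contourTrans (fieldLink F κ A₁) emb Γ)
              + (avgOp qin (contourTrans (fieldLink F κ A₀) emb Γ))ᵀ
                * (avgOp qin (contourTrans (fieldLink F κ A₁) emb Γ)
                  - avgOp qin (contourTrans (fieldLink F κ A₀) emb Γ))) := by
  simp_rw [← transpose_mul_sub_split₁]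
  unfold b4Op covOp projOp covLap
  simp only [smul_sub, Finset.sum_sub_distrib]
  abel

omit [DecidableEq Y] in
/-- **THE BILINEAR FORM OF `H(A₁) − H(A₀)`**: `⟨u, (H₁−H₀)y⟩ = Σ_{x,y} c[⟨(D₁−D₀)u, D₁y⟩ + ⟨D₀u, (D₁−D₀)y⟩] +
a[⟨(Q₁−Q₀)u, Q₁y⟩ + ⟨Q₀u, (Q₁−Q₀)y⟩]` — every term carries ONE first-order difference of link variables (the form in
which `⟨r, y⟩` is estimated). [cite: Balaban1983RegularityDecay, (1.3)–(1.6) p.572, p.590] -/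
theorem form_b4Op_sub (F : OrthFlow ι) (κ : ℝ) (c : X → X → ℝ) (m2 a : ℝ) (qin : Y → X → ℝ) (emb : Y → X)
    (Γ : Y → X → List X) (A₀ A₁ : X → X → ℝ) (u y : X × ι → ℝ) :
    u ⬝ᵥ ((b4Op F κ c m2 a qin emb Γ A₁ - b4Op F κ c m2 a qin emb Γ A₀) *ᵥ y)
      = (∑ x, ∑ z, c x z *
          ((((bondDiff (fieldLink F κ A₁) x z - bondDiff (fieldLink F κ A₀) x z) *ᵥ u)
              ⬝ᵥ (bondDiff (fieldLink F κ A₁) x z *ᵥ y))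
            + ((bondDiff (fieldLink F κ A₀) x z *ᵥ u)
              ⬝ᵥ ((bondDiff (fieldLink F κ A₁) x z - bondDiff (fieldLink F κ A₀) x z) *ᵥ y))))
        + a * ((((avgOp qin (contourTrans (fieldLink F κ A₁) emb Γ)
                    - avgOp qin (contourTrans (fieldLink F κ A₀) emb Γ)) *ᵥ u)
                ⬝ᵥ (avgOp qin (contourTrans (fieldLink F κ A₁) emb Γ) *ᵥ y))
              + ((avgOp qin (contourTrans (fieldLink F κ A₀) emb Γ) *ᵥ u)
                ⬝ᵥ ((avgOp qin (contourTrans (fieldLink F κ A₁) emb Γ)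
                    - avgOp qin (contourTrans (fieldLink F κ A₀) emb Γ)) *ᵥ y))) := by
  rw [b4Op_sub_eq, Matrix.add_mulVec, dotProduct_add, Matrix.sum_mulVec, dotProduct_sum, Matrix.smul_mulVec,
    dotProduct_smul, smul_eq_mul, Matrix.add_mulVec, dotProduct_add, dotProduct_transpose_mul_mulVec',
    dotProduct_transpose_mul_mulVec']
  congr 1
  refine Finset.sum_congr rfl fun x _ => ?_
  rw [Matrix.sum_mulVec, dotProduct_sum]
  refine Finset.sum_congr rfl fun z _ => ?_
  rw [Matrix.smul_mulVec, dotProduct_smul, smul_eq_mul, Matrix.add_mulVec, dotProduct_add,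
    dotProduct_transpose_mul_mulVec', dotProduct_transpose_mul_mulVec']

end Split

/-! ## §4. The variational bound for the second-order term `⟨r, G_k(Δ,A₁)r⟩` -/

section Variational

variable {n : Type*} [Fintype n] [DecidableEq n]

/-- **VARIATIONAL BOUND**: for an invertible `H` and `G = H⁻¹`, if `2⟨r,y⟩ − ⟨y,Hy⟩ ≤ M` for every `y`, then
`⟨r, Gr⟩ ≤ M` (take `y = Gr`) — the tool by which «Using Lemma 2.1» (the bounds on `G_k`) controls the second-order
term `⟨r, G_k(Δ,A₁)r⟩` of the remainder. [cite: Balaban1983RegularityDecay, p.590 «Using Lemma 2.1 the remaining terms can be easily estimated»] -/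
theorem dotProduct_inv_mulVec_le_of_forall {H : Matrix n n ℝ} (hH : IsUnit H.det) (r : n → ℝ) {M : ℝ}
    (h : ∀ y : n → ℝ, 2 * (r ⬝ᵥ y) - y ⬝ᵥ (H *ᵥ y) ≤ M) : r ⬝ᵥ (H⁻¹ *ᵥ r) ≤ M := by
  have h1 := h (H⁻¹ *ᵥ r)
  have h2 : (H⁻¹ *ᵥ r) ⬝ᵥ (H *ᵥ (H⁻¹ *ᵥ r)) = r ⬝ᵥ (H⁻¹ *ᵥ r) := by
    rw [Matrix.mulVec_mulVec, Matrix.mul_nonsing_inv _ hH, Matrix.one_mulVec, dotProduct_comm]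
  linarith

/-- … and `⟨r, Gr⟩ ≥ 0` when `H` is positive definite, so that `|⟨r, Gr⟩| ≤ M`. [cite: Balaban1983RegularityDecay, (1.8) p.573, p.590] -/
theorem dotProduct_inv_mulVec_nonneg {H : Matrix n n ℝ} (hH : H.PosDef) (r : n → ℝ) : 0 ≤ r ⬝ᵥ (H⁻¹ *ᵥ r) := by
  have h := hH.inv.posSemidef.dotProduct_mulVec_nonneg r
  rwa [star_trivial] at h

end Variational



end

end Literature.MathematicalPhysics.QuantumFieldTheory.Balaban1983to89.B4Eq47Expansion
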